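import Summits.ABC.ABC.Theses.DefiniteXi
import Literature.NumberTheory.Automorphic.CDTTheorem712
import Literature.NumberTheory.Automorphic.CDTTheorem722
import Literature.NumberTheory.Automorphic.LanglandsTunnellModThree
import Literature.NumberTheory.EllipticCurves.Szpiro
import HarnessLib

/-!
# Stub ideas for `stub_modThree` — ideator k = 3, GENERATION 11 (home family 3: probe the extremes)

Typed helper signatures for `STUB-IDEAS-stub_modThree-3.md` (gen 11).  Nothing here is registered;
the skeleton `Lines/Sketch.lean` is untouched.  `sorry` only inside the declared stubs
`stub_not_strictSwitchThree`, `stub_fourTransfer`, `stub_padicValRat_two_j_freyCurve`; the two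
compositions `hOne_tame_of` (plan P-T: the skeleton's `h1` on curves semistable at `2`, WITHOUT
`stub_modThree`) and `isModular_freyCurve_tame_of` (plan P-L: the semistable-at-`2` half of the Frey
family WITHOUT `stub_modThree` AND WITHOUT `stub_liftThree`) are kernel-checked from named `Prop`s.

The three corrections of this generation are recorded as definitions:
* `AllenTarget` uses `v₂(j) ≤ 0` (NOT `< 0`: the curve 37a1, good supersingular at `2` with
  `a₂ = -2 ≢ 0 (mod 3)`, has no congruent curve mod `3` that is potentially multiplicative at `2`,
  see `StrictSwitchThree` / `stub_not_strictSwitchThree`) and carries `W.j ≠ 0` (the junk value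
  `padicValRat 2 0 = 0` would otherwise let the `j = 0` curves into Allen's hypothesis (1));
* `SwitchFiveAllen` is hypothesised on near-ordinarity `W.j ≠ 0 ∧ v₂(j_W) ≤ 0`, not on
  `¬ 4 ∣ N_W`: at level `5` a good supersingular curve with `a₂ = 0` (Frobenius irreducible on
  `E[5]`) has NO nearly-ordinary congruent curve, while at level `3` every curve semistable at `2`
  has one (`SwitchThreeAllen`, = gen-2 `three_two_switch`).
-/

set_option linter.dupNamespace false

noncomputable section

open scoped MatrixGroups NumberField
open NumberField IsDedekindDomain
open Literature.NumberTheory.EllipticCurves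
open Literature.NumberTheory.EllipticCurves.ModularForms
open Literature.NumberTheory.Automorphic
open Literature.NumberTheory.Automorphic.BCDT
open Literature.NumberTheory.GaloisRepresentations
open WeierstrassCurve

namespace Summit.ABC.ABC.Cruxes.FreyModularity.StubIdeasModThree3G11

/-- The statement of `stub_modThree` (verbatim, `Lines/Sketch.lean` l.143). -/
abbrev SigStubModThree : Prop :=
  ∀ (W : WeierstrassCurve ℚ) [W.IsElliptic] (ρ : ModPGaloisRep ℚ (ZMod 3) 2),
    W.IsTorsionGaloisRep 3 ρ → FramedRep.IsAbsolutelyIrreducible ρ → ρ.IsModular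

/-- The junk value that makes `padicValRat 2 W.j ≤ 0` vacuously true at `j = 0`. -/
example : padicValRat 2 (0 : ℚ) ≤ 0 := by simp

/-! ## The common TARGET of both switches: Allen's hypotheses (Allen 2014, Corollary, `F = ℚ`) -/

/-- Allen's hypotheses on an elliptic curve over `ℚ`, with the REAL resolvent (`Δ > 0`, so Allen's
condition (3) is void): `j ≠ 0`, `v₂(j) ≤ 0` (potentially multiplicative OR potentially ordinary —
`≤`, not `<`), the `2`-division cubic has no rational root and `Δ` is a positive non-square
(`ℚ(E[2])` has group `S₃`).  [cite: Allen2014, Corollary (Introduction), §5.3.1] -/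
def AllenTarget (W : WeierstrassCurve ℚ) [W.IsElliptic] : Prop :=
  W.j ≠ 0 ∧ padicValRat 2 W.j ≤ 0 ∧ (∀ x : ℚ, ¬ W.twoTorsionPolynomial.toPoly.IsRoot x) ∧
    ¬ IsSquare W.Δ ∧ 0 < W.Δ

/-- **H1 (named fact, XL behind it but ONE fact; = gen-2 `allen_corollary_rat` with `W.j ≠ 0`
added).**  Allen 2014, Corollary with `F = ℚ`: `v₂(j_E) ≤ 0`, no rational `2`-torsion, `Δ ∉ ℚ²`,
and (`Δ < 0 ⇒ Δ ∉ ℚ₂²`) imply `E` is modular.  Interface to the tree's Galois-side fact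
`Allen2014_modularity_nearlyOrdinaryDihedral_Q` = gen-3 `allenOutput_of_fact` + weight/untwist glue.
[cite: Allen2014, Corollary (Introduction) and §5.3.1] -/
def AllenCurveQ : Prop :=
  ∀ (W : WeierstrassCurve ℚ) [W.IsElliptic] [NeZero (W.conductorNorm ℤ)],
    W.j ≠ 0 → padicValRat 2 W.j ≤ 0 →
    (∀ x : ℚ, ¬ W.twoTorsionPolynomial.toPoly.IsRoot x) → ¬ IsSquare W.Δ →
    (W.Δ < 0 → ¬ IsSquare (W.Δ : ℚ_[2])) → IsModular W

/-- Allen applied to a switch target (XS glue, proved). -/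
theorem isModular_of_allenTarget (hA : AllenCurveQ) {W : WeierstrassCurve ℚ} [W.IsElliptic]
    [NeZero (W.conductorNorm ℤ)] (h : AllenTarget W) : IsModular W :=
  hA W h.1 h.2.1 h.2.2.1 h.2.2.2.1 fun hneg ↦ absurd h.2.2.2.2 (not_lt.mpr hneg.le)

/-! ## Plan P-T — the `3`–`2` switch (level 3): hypothesis = semistable at `2`, target `v₂(j'') ≤ 0` -/

/-- **H2 (M–L, provable; = gen-2 `three_two_switch` with the Allen target spelled out).**  For `E/ℚ`
semistable at `2` (`4 ∤ N_E`) and a framed model `ρ̄` of `E[3]` there is `E''/ℚ` with `E''[3] ≅ E[3]`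
(the same `ρ̄`) satisfying Allen's hypotheses with `Δ'' > 0`.  Mechanism: `X_E(3) ≅ ℙ¹_ℚ`
(Rubin–Silverberg's explicit family `ℰ_t`), weak approximation at `{2, ∞}`, Hilbert irreducibility for
the `2`-division cubic (geometric monodromy of level `2` over `X(3)` is `SL₂(ℤ/2) ≅ S₃`).  The local
point at `2` exists in EVERY semistable case: `E[3]|_{G_{ℚ₂}}` unramified with `tr Frob₂ ≡ 0` ↔ a Tate
curve with `3 ∣ v(q)`; `tr Frob₂ ≡ ±1` (Frobenius irreducible, e.g. good supersingular `a₂ = ±2`) ↔ a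
good ORDINARY curve with `a₂ = ±1` (`v₂(j'') = 0` — whence `≤`, not `<`); multiplicative with
`3 ∤ v(q)` ↔ Tate curves (both Kummer classes / symplectic types occur).
[cite: RubinSilverberg1995, Thm. 4.1, Rem. 4.2] [cite: Allen2014, §5.3.2] -/
def SwitchThreeAllen : Prop :=
  ∀ (W : WeierstrassCurve ℚ) [W.IsElliptic] (ρ : ModPGaloisRep ℚ (ZMod 3) 2),
    W.IsTorsionGaloisRep 3 ρ → ¬ 4 ∣ W.conductorNorm ℤ →
    ∃ (W'' : WeierstrassCurve ℚ) (_ : W''.IsElliptic), W''.IsTorsionGaloisRep 3 ρ ∧ AllenTarget W''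

/-- **Autopsy of gen 3 (family 3, the boundary `v₂(j) = 0`): the STRICT switch is false.**  Gen-3
`stubB3_switch_plus` demanded `v₂(j'') < 0` (potentially multiplicative).  Witness `W = 37a1`
(`y² + y = x³ − x`, `N = 37`, good supersingular at `2`, `a₂ = −2`, `ρ̄_{E,3}` onto `GL₂(𝔽₃)`): a
curve `W''` with `W''[3] ≅ W[3]` and `v₂(j'') < 0` is potentially multiplicative at `2`, so
`W''[3]|_{G_{ℚ₂}} ≅ ψ ⊗ (χ̄₃ ∗; 0 1)`; being unramified (`≅ W[3]|_{G_{ℚ₂}}`) forces `ψ` unramified and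
`tr Frob₂ = ψ(2)(2 + 1) ≡ 0 (mod 3)`, whereas `tr ρ̄_{W,3}(Frob₂) ≡ a₂(W) = −2 ≢ 0`.  [folklore] -/
def StrictSwitchThree : Prop :=
  ∀ (W : WeierstrassCurve ℚ) [W.IsElliptic] (ρ : ModPGaloisRep ℚ (ZMod 3) 2),
    W.IsTorsionGaloisRep 3 ρ → ¬ 4 ∣ W.conductorNorm ℤ →
    ∃ (W'' : WeierstrassCurve ℚ) (_ : W''.IsElliptic), W''.IsTorsionGaloisRep 3 ρ ∧
      padicValRat 2 W''.j < 0

/-- The witness curve 37a1: `y² + y = x³ − x`. -/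
def curve37a1 : WeierstrassCurve ℚ := ⟨0, 0, 1, -1, 0⟩

/-- `Δ(37a1) = 37` (so `N = 37`, good reduction at `2`). -/
theorem curve37a1_Δ : curve37a1.Δ = 37 := by
  norm_num [curve37a1, WeierstrassCurve.Δ, WeierstrassCurve.b₂, WeierstrassCurve.b₄,
    WeierstrassCurve.b₆, WeierstrassCurve.b₈]

/-- `c₄(37a1) = 48`, so `j = 48³/37 = 2¹²·3³/37` and `v₂(j) = 12 > 0` (supersingular at `2`). -/
theorem curve37a1_c₄ : curve37a1.c₄ = 48 := by
  norm_num [curve37a1, WeierstrassCurve.c₄, WeierstrassCurve.b₂, WeierstrassCurve.b₄]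

/-- **Stub N (S–M, a refutation for the record):** `¬ StrictSwitchThree`, by `curve37a1` and the
trace of `Frob₂` (tree: `trace_galoisRepTate_frobenius_of_hasGoodReductionAt_holds` read mod `3`,
plus the Tate-curve shape of `E[3]|_{G_{ℚ₂}}` for `v₂(j) < 0`). [folklore] -/
theorem stub_not_strictSwitchThree : ¬ StrictSwitchThree := by
  sorry

/-- **H3 (S–M; = gen-2 `fourTransfer`, the landed `stub_nineTransfer` (p110220) with `3 ↦ 2`):**
semistability at `2` transfers along a common framed model of `E[5]`, `E'[5]` (a non-trivial
unipotent in the inertia image has order `5 ∤ 24 = #SL₂(𝔽₃)`, so `E'` is not potentially good with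
`Φ₂ ≠ 1` nor a ramified twist of a Tate curve).  Call site (ii) of the skeleton (the switch partner
`W'`). [cite: SilverbergCSS1997, Prop. 7.1] -/
theorem stub_fourTransfer :
    ∀ (W W' : WeierstrassCurve ℚ) [W.IsElliptic] [W'.IsElliptic] (ρ : ModPGaloisRep ℚ (ZMod 5) 2),
      W.IsTorsionGaloisRep 5 ρ → W'.IsTorsionGaloisRep 5 ρ →
      ¬ 4 ∣ W.conductorNorm ℤ → ¬ 4 ∣ W'.conductorNorm ℤ := by
  sorry

/-- **Plan P-T, composition (XS, proved): the skeleton's hypothesis `h1` of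
`isModular_freyCurve_of_stubs`, RESTRICTED to curves semistable at `2`, from H1 + H2 + the registered
stubs S1b (`stub_liftThree`) and S9 (`stub_threeImpTwo`) — `stub_modThree` (Langlands–Tunnell) is not
used.**  With H3 this serves both call sites on the Frey classes `16 ∣ B` (`A ≡ −1 (mod 4)`). -/
theorem hOne_tame_of (hA : AllenCurveQ) (hS3 : SwitchThreeAllen)
    (hliftThree : ∀ (W : WeierstrassCurve ℚ) [W.IsElliptic] (ρ : ModPGaloisRep ℚ (ZMod 3) 2),
      W.IsTorsionGaloisRep 3 ρ → ρ.IsAbsIrreducibleOverSqrt (-3) → ¬ 9 ∣ W.conductorNorm ℤ →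
      ρ.IsModular → W.IsModularGaloisRepTate 3)
    (h32 : ∀ (W : WeierstrassCurve ℚ) [W.IsElliptic] [NeZero (W.conductorNorm ℤ)] (ℓ : ℕ)
      [Fact ℓ.Prime], W.IsModularGaloisRepTate ℓ → IsModular W) :
    ∀ (W : WeierstrassCurve ℚ) [W.IsElliptic] [NeZero (W.conductorNorm ℤ)]
      (ρ : ModPGaloisRep ℚ (ZMod 3) 2), W.IsTorsionGaloisRep 3 ρ →
      ρ.IsAbsIrreducibleOverSqrt (-3) → ¬ 9 ∣ W.conductorNorm ℤ → ¬ 4 ∣ W.conductorNorm ℤ →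
      IsModular W := by
  intro W _ _ ρ hρ h3i h9 h4
  haveI : Fact (Nat.Prime 3) := ⟨Nat.prime_three⟩
  obtain ⟨W'', hW'', hρ'', hT⟩ := hS3 W ρ hρ h4
  haveI := hW''
  haveI : NeZero (W''.conductorNorm ℤ) := ⟨(conductorNorm_pos_holds W'').ne'⟩
  have hmod : ρ.IsModular := (isModular_of_allenTarget hA hT).isModular_of_isTorsionGaloisRep'' hρ''
  exact h32 W 3 (hliftThree W ρ hρ h3i h9 hmod)

/-! ## Plan P-L — the `5`–`2` switch (level 5): bypass BOTH `stub_modThree` and `stub_liftThree` -/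

/-- **H4 (M–L, provable; the Allen-flavoured variant of the Shepherd-Barron–Taylor/CDT switch).**
For `E/ℚ` NEARLY ORDINARY at `2` (`j ≠ 0`, `v₂(j) ≤ 0`) and a framed model `ρ̄` of `E[5]` there is
`E'/ℚ` with `E'[5] ≅ E[5]` (the same `ρ̄`) satisfying Allen's hypotheses with `Δ' > 0`.  Mechanism:
`X_E(5) ≅ ℙ¹_ℚ` (it has the rational point `[E]`); weak approximation at `2` near `[E]` (so
`v₂(j') = v₂(j) ≤ 0`) and at `∞` near a real point with `j > 1728` (every real curve lies on
`X_E(5)(ℝ)`: the centraliser of a reflection in `GL₂(𝔽₅)` has both determinants; `Δ' > 0 ⇔ j' > 1728`);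
Hilbert irreducibility for the `2`-division field (geometric monodromy of level `2` over `X(5)` is
`SL₂(ℤ/2) ≅ S₃`, as `SL₂(ℤ/10) ≅ SL₂(ℤ/2) × SL₂(ℤ/5)`).  The hypothesis is near-ordinarity, NOT
`4 ∤ N_E`: a good supersingular curve with `a₂ = 0` has `Frob₂` irreducible on `E[5]` (`X² + 2`
irreducible mod `5`), so no congruent curve mod `5` is nearly ordinary at `2`.
[cite: ConradDiamondTaylor1999, proof of Thm. 7.1.2 (p. 556)] [cite: Allen2014, §5.3.2] -/
def SwitchFiveAllen : Prop :=
  ∀ (W : WeierstrassCurve ℚ) [W.IsElliptic] (ρ : ModPGaloisRep ℚ (ZMod 5) 2),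
    W.IsTorsionGaloisRep 5 ρ → W.j ≠ 0 → padicValRat 2 W.j ≤ 0 →
    ∃ (W' : WeierstrassCurve ℚ) (_ : W'.IsElliptic), W'.IsTorsionGaloisRep 5 ρ ∧ AllenTarget W'

/-- **H5 (S; proved elsewhere in this crux dir as `padicValRat_j_freyCurve_of_two_dvd`,
`STUB_IDEAS_stub_threeImpTwo_2g6_Sketch.lean` l.287): the tame half of the Frey family is nearly
ordinary at `2`.**  For `A` odd and `16 ∣ B`: `j = 2⁸(A² + AB + B²)³/(AB(A+B))² ≠ 0` and
`v₂(j) = 8 − 2·v₂(B) ≤ 0` (Diamond–Kramer 1995, Lemma 2: good ordinary if `16 ∥ B`, multiplicative if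
`32 ∣ B`, for `A ≡ −1 (mod 4)`). [cite: DiamondKramer1995, Lemma 2] -/
theorem stub_padicValRat_two_j_freyCurve {A B : ℤ} [(freyCurve A B).IsElliptic]
    (h0 : A * B * (A + B) ≠ 0) (hA : Odd A) (hB : (16 : ℤ) ∣ B) :
    (freyCurve A B).j ≠ 0 ∧ padicValRat 2 (freyCurve A B).j ≤ 0 := by
  sorry

/-- **Plan P-L, composition (XS, proved): every Frey curve nearly ordinary at `2` is modular from
H1 (Allen) + H4 (the level-`5` switch) + the skeleton's `h2` (= `liftFive_of_stubs stub_liftFive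
stub_threeImpTwo`), `h4a` (= `isIrreducible_freyCurve_five`, landed inputs), `h4b`
(= `Summit.ABC.ABC.Theorems.stub_absIrrSqrtFive`, landed) and `25 ∤ N`
(= `not_twentyFive_dvd_conductorNorm_freyCurve`, proved in the skeleton).**  Neither `stub_modThree`
(Langlands–Tunnell) nor `stub_liftThree` (modularity lifting at `3`) nor the CDT `3`–`5` switch is used:
on the classes `16 ∣ B` the whole `3`-adic half of Wiles' argument is replaced by Allen's `2`-adic
theorem.  [cite: Allen2014, Corollary] [cite: ConradDiamondTaylor1999, Thm. 7.1.2 (proof, p. 556)] -/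
theorem isModular_freyCurve_tame_of (hA : AllenCurveQ) (hS5 : SwitchFiveAllen)
    (h2 : ∀ (W : WeierstrassCurve ℚ) [W.IsElliptic] [NeZero (W.conductorNorm ℤ)],
      ¬ 25 ∣ W.conductorNorm ℤ →
      ∀ (ρ : ModPGaloisRep ℚ (ZMod 5) 2), W.IsTorsionGaloisRep 5 ρ →
      ρ.IsAbsIrreducibleOverSqrt 5 → ρ.IsModular → IsModular W)
    (h4a : ∀ a b : ℤ, IsCoprime a b → a * b * (a + b) ≠ 0 →
      ∀ ρ : ModPGaloisRep ℚ (ZMod 5) 2, (freyCurve a b).IsTorsionGaloisRep 5 ρ →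
        FramedRep.IsIrreducible ρ)
    (h4b : ∀ (W : WeierstrassCurve ℚ) [W.IsElliptic], ¬ 25 ∣ W.conductorNorm ℤ →
      ∀ ρ : ModPGaloisRep ℚ (ZMod 5) 2, W.IsTorsionGaloisRep 5 ρ →
        FramedRep.IsIrreducible ρ → ρ.IsAbsIrreducibleOverSqrt 5)
    (h25 : ∀ a b : ℤ, IsCoprime a b → a * b * (a + b) ≠ 0 →
      ¬ 25 ∣ (freyCurve a b).conductorNorm ℤ)
    {a b : ℤ} (hab : IsCoprime a b) (h0 : a * b * (a + b) ≠ 0)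
    [(freyCurve a b).IsElliptic] [NeZero ((freyCurve a b).conductorNorm ℤ)]
    (hj0 : (freyCurve a b).j ≠ 0) (hj : padicValRat 2 (freyCurve a b).j ≤ 0) :
    IsModular (freyCurve a b) := by
  haveI : Fact (Nat.Prime 5) := ⟨by norm_num⟩
  have h25' : ¬ 25 ∣ (freyCurve a b).conductorNorm ℤ := h25 a b hab h0
  obtain ⟨ρ, hρ⟩ := (freyCurve a b).exists_isTorsionGaloisRep 5
  have hirr : FramedRep.IsIrreducible ρ := h4a a b hab h0 ρ hρ
  have h5 : ρ.IsAbsIrreducibleOverSqrt 5 := h4b (freyCurve a b) h25' ρ hρ hirr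
  -- the `5`–`2` switch: a congruent curve mod 5 satisfying Allen's hypotheses
  obtain ⟨W', hW', hρ', hT⟩ := hS5 (freyCurve a b) ρ hρ hj0 hj
  haveI := hW'
  haveI : NeZero (W'.conductorNorm ℤ) := ⟨(conductorNorm_pos_holds W').ne'⟩
  -- `E'` is modular by Allen, so `ρ̄ = ρ̄_{E,5} = ρ̄_{E',5}` is modular, and `E` is modular by lifting at `5`
  have hE' : IsModular W' := isModular_of_allenTarget hA hT
  exact h2 (freyCurve a b) h25' ρ hρ h5 (hE'.isModular_of_isTorsionGaloisRep'' hρ')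

/-- **Plan P-L on the Frey classes `A` odd, `16 ∣ B` (XS, proved from H5).** -/
theorem isModular_freyCurve_sixteen_dvd_of (hA : AllenCurveQ) (hS5 : SwitchFiveAllen)
    (h2 : ∀ (W : WeierstrassCurve ℚ) [W.IsElliptic] [NeZero (W.conductorNorm ℤ)],
      ¬ 25 ∣ W.conductorNorm ℤ →
      ∀ (ρ : ModPGaloisRep ℚ (ZMod 5) 2), W.IsTorsionGaloisRep 5 ρ →
      ρ.IsAbsIrreducibleOverSqrt 5 → ρ.IsModular → IsModular W)
    (h4a : ∀ a b : ℤ, IsCoprime a b → a * b * (a + b) ≠ 0 →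
      ∀ ρ : ModPGaloisRep ℚ (ZMod 5) 2, (freyCurve a b).IsTorsionGaloisRep 5 ρ →
        FramedRep.IsIrreducible ρ)
    (h4b : ∀ (W : WeierstrassCurve ℚ) [W.IsElliptic], ¬ 25 ∣ W.conductorNorm ℤ →
      ∀ ρ : ModPGaloisRep ℚ (ZMod 5) 2, W.IsTorsionGaloisRep 5 ρ →
        FramedRep.IsIrreducible ρ → ρ.IsAbsIrreducibleOverSqrt 5)
    (h25 : ∀ a b : ℤ, IsCoprime a b → a * b * (a + b) ≠ 0 →
      ¬ 25 ∣ (freyCurve a b).conductorNorm ℤ)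
    (hH5 : ∀ {A B : ℤ} [(freyCurve A B).IsElliptic], A * B * (A + B) ≠ 0 → Odd A → (16 : ℤ) ∣ B →
      (freyCurve A B).j ≠ 0 ∧ padicValRat 2 (freyCurve A B).j ≤ 0)
    {a b : ℤ} (hab : IsCoprime a b) (h0 : a * b * (a + b) ≠ 0) (ha : Odd a) (hb : (16 : ℤ) ∣ b)
    [(freyCurve a b).IsElliptic] [NeZero ((freyCurve a b).conductorNorm ℤ)] :
    IsModular (freyCurve a b) :=
  isModular_freyCurve_tame_of hA hS5 h2 h4a h4b h25 hab h0 (hH5 h0 ha hb).1 (hH5 h0 ha hb).2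

end Summit.ABC.ABC.Cruxes.FreyModularity.StubIdeasModThree3G11

end
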